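import Summits.Ventures.HodgeRepro2.HeckeSlashOperator
import Summits.Ventures.HodgeRepro2.BallQuotientCoverMeasure
import Summits.Ventures.HodgeRepro2.BallQuotientCompactTransfer
import Summits.Ventures.HodgeRepro2.BallQuotientMeasureLocallyFinite
import Summits.Ventures.HodgeRepro2.PeterssonFundamentalDomain
import Summits.Ventures.HodgeRepro2.CoveringIntegralBall

/-!
# Hecke operators are self-adjoint for the Petersson inner product

Kernel support for the blind cell pub-hodge-repro2 (seat p2), Tier 5 (Hecke side).  For the double-coset
operators `T_δ f = ∑_q f ∥_k (δ r_q)` of `HeckeSlashOperator.lean`, a compact quotient `S\𝔹²`, and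
continuous weight-`k` forms `f, g` for `S`:

  `⟨T_δ f, g⟩_S = ⟨f ∥_k δ, g⟩_{S_δ} = ⟨f, g ∥_k δ⁻¹⟩_{S_{δ⁻¹}} = ⟨f, T_{δ⁻¹} g⟩_S`

— the first and last equalities by the change of variables `z ↦ r_q z` term by term (the translates
`r_q D` of a fundamental domain of `S` form a fundamental domain of `S_δ`, `BallQuotientCoverMeasure.lean`),
the middle one by the change of variables `z ↦ δz` (which carries fundamental domains of `S_δ` to
fundamental domains of `S_{δ⁻¹} = δ S_δ δ⁻¹`) and the independence of the fundamental domain.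
-/

namespace Summit.Ventures.HodgeRepro2.ShimuraData

open MeasureTheory
open scoped Pointwise

variable {K : Type*} [Field K] [NumberField K] [NumberField.IsCMField K]
    {τ₁ : K →+* ℂ} {H : Matrix (Fin 3) (Fin 3) K} {Q : Matrix (Fin 3) (Fin 3) ℂ}

section Prelim

variable (S : Subgroup (GL (Fin 3) K))

/-- `S_δ ⊆ U(H)(K)`. -/
theorem heckeSubgroup_subset_unitaryGroup (hS : (S : Set (GL (Fin 3) K)) ⊆ unitaryGroup K H)
    (δ : GL (Fin 3) K) :
    ((heckeSubgroup S δ : Subgroup (GL (Fin 3) K)) : Set (GL (Fin 3) K)) ⊆ unitaryGroup K H :=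
  fun _ hγ => hS (heckeSubgroup_le S δ hγ)

/-- `f ∥_k δ` is a weight-`k` function for `S_δ = S ∩ δ⁻¹ S δ` when `f` is one for `S`. -/
theorem IsWeightFor.slash_heckeSubgroup (hQ : IsFrame K τ₁ H Q)
    (hS : (S : Set (GL (Fin 3) K)) ⊆ unitaryGroup K H) {δ : GL (Fin 3) K} (hδ : δ ∈ unitaryGroup K H) {k : ℕ}
    {f : (Fin 2 → ℂ) → ℂ} (hf : IsWeightFor τ₁ Q S k f) :
    IsWeightFor τ₁ Q (heckeSubgroup S δ) k (slash k (realEmbedding K τ₁ Q δ) f) := by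
  intro γ hγ z hz
  obtain ⟨hγS, hγ'⟩ := (mem_heckeSubgroup S δ).mp hγ
  have hδU : IsInU21 (realEmbedding K τ₁ Q δ) := IsFrame.isInU21_realEmbedding hQ hδ
  have hγU : IsInU21 (realEmbedding K τ₁ Q γ) := IsFrame.isInU21_realEmbedding hQ (hS hγS)
  have hDz : autFactor (realEmbedding K τ₁ Q γ) z ≠ 0 := IsInU21.autFactor_ne_zero hγU hz
  rw [← slash_eq_self_iff hDz, ← slash_mul k hγU f hz, ← IsFrame.realEmbedding_mul hQ]
  have h2 : δ * γ = (δ * γ * δ⁻¹) * δ := by group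
  rw [h2]
  exact slash_mul_mem_eq hQ S hS k hf hγ' hδ hz

/-- The polarised density is additive in the first variable over finite sums. -/
theorem peterssonPair_sum_left (k : ℕ) {ι : Type*} (s : Finset ι) (f : ι → (Fin 2 → ℂ) → ℂ)
    (g : (Fin 2 → ℂ) → ℂ) (z : Fin 2 → ℂ) :
    peterssonPair k (fun w => ∑ i ∈ s, f i w) g z = ∑ i ∈ s, peterssonPair k (f i) g z := by
  unfold peterssonPair
  rw [Finset.sum_mul, Finset.sum_mul]

/-- The polarised density is additive in the second variable over finite sums. -/
theorem peterssonPair_sum_right (k : ℕ) {ι : Type*} (s : Finset ι) (f : (Fin 2 → ℂ) → ℂ)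
    (g : ι → (Fin 2 → ℂ) → ℂ) (z : Fin 2 → ℂ) :
    peterssonPair k f (fun w => ∑ i ∈ s, g i w) z = ∑ i ∈ s, peterssonPair k f (g i) z := by
  unfold peterssonPair
  rw [map_sum, Finset.mul_sum, Finset.sum_mul]

/-- On a compact quotient, the polarised density of two continuous weight-`k` forms is integrable on
every fundamental domain `D` (against the Bergman measure on `𝔹²`). -/
theorem integrableOn_peterssonPair (hQ : IsFrame K τ₁ H Q)
    (hS : (S : Set (GL (Fin 3) K)) ⊆ unitaryGroup K H) [CompactSpace (ballQuotient hQ S hS)] {D : Set ball₂}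
    (hD : IsBallFundamentalDomain hQ S hS D) {k : ℕ} {f g : (Fin 2 → ℂ) → ℂ}
    (hf : IsWeightFor τ₁ Q S k f) (hg : IsWeightFor τ₁ Q S k g) (hfc : ContinuousOn f ball₂)
    (hgc : ContinuousOn g ball₂) :
    IntegrableOn (fun z : ball₂ => peterssonPair k f g (z : Fin 2 → ℂ)) D bergmanBall := by
  haveI := isFiniteMeasureOnCompacts_quotientMeasure hQ S hS hD
  have hint : Integrable (peterssonPairQuotient hQ S hS hf hg) (quotientMeasure hQ S hS D) :=
    integrable_peterssonPairQuotient hQ S hS _ hf hg hfc hgc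
  unfold quotientMeasure at hint
  rw [integrable_map_measure (continuous_peterssonPairQuotient hQ S hS hf hg hfc hgc).aestronglyMeasurable
    (measurable_ballQuotient_mk hQ S hS).aemeasurable] at hint
  have : (peterssonPairQuotient hQ S hS hf hg ∘ ballQuotient.mk hQ S hS) =
      fun z : ball₂ => peterssonPair k f g (z : Fin 2 → ℂ) := by
    funext z
    exact peterssonPairQuotient_mk hQ S hS hf hg z
  rw [this] at hint
  exact hint

end Prelim

section Terms

variable (hQ : IsFrame K τ₁ H Q) (S : Subgroup (GL (Fin 3) K))
    (hS : (S : Set (GL (Fin 3) K)) ⊆ unitaryGroup K H)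

/-- The image of `D` under the measurable equivalence of `r ∈ S` is the translate `r • D`. -/
theorem image_ballMeasurableEquiv_eq_smul (r : S) (D : Set ball₂) :
    letI := frameAction hQ S hS
    ballMeasurableEquiv hQ (hS r.property) '' D = r • D := by
  letI := frameAction hQ S hS
  ext z
  simp only [Set.mem_image, Set.mem_smul_set]
  constructor
  · rintro ⟨w, hw, rfl⟩
    exact ⟨w, hw, Subtype.ext (by rw [frameAction_smul_coe]; rfl)⟩
  · rintro ⟨w, hw, rfl⟩
    exact ⟨w, hw, Subtype.ext (by rw [frameAction_smul_coe]; rfl)⟩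

/-- **Term-wise change of variables**: for `r ∈ S` and `g` of weight `k` for `S`,
`∫_D ⟨f ∥ (δ r), g⟩_k dμ_B = ∫_{r • D} ⟨f ∥ δ, g⟩_k dμ_B`. -/
theorem setIntegral_peterssonPair_slash_mul {δ : GL (Fin 3) K} (hδ : δ ∈ unitaryGroup K H) (r : S)
    {D : Set ball₂} (hDm : MeasurableSet D) {k : ℕ} (f : (Fin 2 → ℂ) → ℂ) {g : (Fin 2 → ℂ) → ℂ}
    (hg : IsWeightFor τ₁ Q S k g) :
    ∫ z in D, peterssonPair k (slash k (realEmbedding K τ₁ Q (δ * (r : GL (Fin 3) K))) f) g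
        (z : Fin 2 → ℂ) ∂bergmanBall =
      ∫ w in (letI := frameAction hQ S hS; r • D),
        peterssonPair k (slash k (realEmbedding K τ₁ Q δ) f) g (w : Fin 2 → ℂ) ∂bergmanBall := by
  letI := frameAction hQ S hS
  have hrU : IsInU21 (realEmbedding K τ₁ Q (r : GL (Fin 3) K)) :=
    IsFrame.isInU21_realEmbedding hQ (hS r.property)
  have hδU : IsInU21 (realEmbedding K τ₁ Q δ) := IsFrame.isInU21_realEmbedding hQ hδ
  rw [← image_ballMeasurableEquiv_eq_smul hQ S hS r D, ← setIntegral_ballMeasurableEquiv hQ (hS r.property)]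
  refine setIntegral_congr_fun hDm fun z _ => ?_
  rw [coe_ballMeasurableEquiv_apply, ← peterssonPair_slash k hrU _ g z.property]
  have h1 : slash k (realEmbedding K τ₁ Q (δ * (r : GL (Fin 3) K))) f (z : Fin 2 → ℂ) =
      slash k (realEmbedding K τ₁ Q (r : GL (Fin 3) K)) (slash k (realEmbedding K τ₁ Q δ) f) z := by
    rw [IsFrame.realEmbedding_mul hQ, slash_mul k hrU f z.property]
  have h2 : g (z : Fin 2 → ℂ) = slash k (realEmbedding K τ₁ Q (r : GL (Fin 3) K)) g z :=
    ((slash_eq_self_iff (IsInU21.autFactor_ne_zero hrU z.property)).mpr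
      (hg r r.property z z.property)).symm
  unfold peterssonPair
  rw [h1]
  conv_lhs => rw [h2]

end Terms

section Main

variable (hQ : IsFrame K τ₁ H Q) (S : Subgroup (GL (Fin 3) K))
    (hS : (S : Set (GL (Fin 3) K)) ⊆ unitaryGroup K H)

omit [NumberField K] [NumberField.IsCMField K] in
/-- Distinct cosets give distinct representatives `(out q)⁻¹`. -/
theorem heckeRep_injective (δ : GL (Fin 3) K) : Function.Injective (heckeRep S δ) := by
  intro q q' h
  unfold heckeRep at h
  have h' := inv_injective h
  rw [← QuotientGroup.out_eq' q, ← QuotientGroup.out_eq' q', h']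

/-- **`⟨T_δ f, g⟩_S = ⟨f ∥_k δ, g⟩_{S_δ}`** (the `S_δ`-product taken against the quotient measure of the
fundamental domain `cosetDomain D = ⋃_q r_q • D`). -/
theorem peterssonInner_hecke_left {δ : GL (Fin 3) K} (hδ : δ ∈ unitaryGroup K H)
    [Fintype (S ⧸ (heckeSubgroup S δ).subgroupOf S)] [CompactSpace (ballQuotient hQ S hS)]
    {D : Set ball₂} (hDm : MeasurableSet D) (hD : IsBallFundamentalDomain hQ S hS D) {k : ℕ}
    {f g : (Fin 2 → ℂ) → ℂ} (hf : IsWeightFor τ₁ Q S k f) (hg : IsWeightFor τ₁ Q S k g)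
    (hfc : ContinuousOn f ball₂) (hgc : ContinuousOn g ball₂) :
    peterssonInner hQ S hS (quotientMeasure hQ S hS D) (hf.hecke hQ S hS hδ) hg =
      peterssonInner hQ (heckeSubgroup S δ) (heckeSubgroup_subset_unitaryGroup S hS δ)
        (quotientMeasure hQ (heckeSubgroup S δ) _ (cosetDomain hQ hS (S' := heckeSubgroup S δ) D))
        (hf.slash_heckeSubgroup S hQ hS hδ) (hg.mono (heckeSubgroup_le S δ)) := by
  letI := frameAction hQ S hS
  haveI : MeasurableConstSMul S ball₂ := measurableConstSMul_frameAction hQ S hS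
  haveI : Finite (S ⧸ (heckeSubgroup S δ).subgroupOf S) := Finite.of_fintype _
  haveI : ((heckeSubgroup S δ).subgroupOf S).FiniteIndex := Subgroup.finiteIndex_of_finite_quotient
  haveI : CompactSpace (ballQuotient hQ (heckeSubgroup S δ) (heckeSubgroup_subset_unitaryGroup S hS δ)) :=
    compactSpace_ballQuotient_of_le hQ (heckeSubgroup_le S δ) hS
  have hδU : IsInU21 (realEmbedding K τ₁ Q δ) := IsFrame.isInU21_realEmbedding hQ hδ
  have hDδ : IsBallFundamentalDomain hQ (heckeSubgroup S δ) (heckeSubgroup_subset_unitaryGroup S hS δ)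
      (cosetDomain hQ hS (S' := heckeSubgroup S δ) D) :=
    isBallFundamentalDomain_cosetDomain hQ (heckeSubgroup_le S δ) hS hDm hD
  -- integrability of `⟨f ∥ δ, g⟩_k` on the union of the translates
  have hintU : IntegrableOn (fun z : ball₂ => peterssonPair k (slash k (realEmbedding K τ₁ Q δ) f) g
      (z : Fin 2 → ℂ)) (cosetDomain hQ hS (S' := heckeSubgroup S δ) D) bergmanBall :=
    integrableOn_peterssonPair (heckeSubgroup S δ) hQ _ hDδ (hf.slash_heckeSubgroup S hQ hS hδ)
      (hg.mono (heckeSubgroup_le S δ)) (continuousOn_slash k hδU hfc) hgc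
  rw [peterssonInner_quotientMeasure hQ S hS D _ hg (continuousOn_hecke hQ S hS hδ k hfc) hgc,
    peterssonInner_quotientMeasure hQ _ _ _ _ _ (continuousOn_slash k hδU hfc) hgc]
  unfold ShimuraData.hecke
  simp_rw [peterssonPair_sum_left]
  -- each term is integrable on `D` (change of variables to `r_q • D ⊆ cosetDomain D`)
  have hterm : ∀ q : S ⧸ (heckeSubgroup S δ).subgroupOf S,
      IntegrableOn (fun z : ball₂ => peterssonPair k
        (slash k (realEmbedding K τ₁ Q (δ * (heckeRep S δ q : GL (Fin 3) K))) f) g (z : Fin 2 → ℂ))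
        D bergmanBall := by
    intro q
    have hrU : IsInU21 (realEmbedding K τ₁ Q (heckeRep S δ q : GL (Fin 3) K)) :=
      IsFrame.isInU21_realEmbedding hQ (hS (heckeRep S δ q).property)
    have hsub : ballMeasurableEquiv hQ (hS (heckeRep S δ q).property) '' D ⊆
        cosetDomain hQ hS (S' := heckeSubgroup S δ) D := by
      rw [image_ballMeasurableEquiv_eq_smul hQ S hS]
      exact Set.subset_iUnion (fun q' : S ⧸ (heckeSubgroup S δ).subgroupOf S => (Quotient.out q')⁻¹ • D) q
    have h1 : IntegrableOn ((fun z : ball₂ => peterssonPair k (slash k (realEmbedding K τ₁ Q δ) f) g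
        (z : Fin 2 → ℂ)) ∘ ballMeasurableEquiv hQ (hS (heckeRep S δ q).property))
        (ballMeasurableEquiv hQ (hS (heckeRep S δ q).property) ⁻¹'
          (ballMeasurableEquiv hQ (hS (heckeRep S δ q).property) '' D)) bergmanBall :=
      ((measurePreserving_ballMeasurableEquiv hQ _).integrableOn_comp_preimage
        (ballMeasurableEquiv hQ _).measurableEmbedding).mpr (hintU.mono_set hsub)
    rw [Set.preimage_image_eq D (ballMeasurableEquiv hQ _).injective] at h1
    refine h1.congr_fun (fun z _ => ?_) hDm
    simp only [Function.comp_apply, coe_ballMeasurableEquiv_apply]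
    rw [← peterssonPair_slash k hrU _ g z.property]
    have e1 : slash k (realEmbedding K τ₁ Q (δ * (heckeRep S δ q : GL (Fin 3) K))) f (z : Fin 2 → ℂ) =
        slash k (realEmbedding K τ₁ Q (heckeRep S δ q : GL (Fin 3) K)) (slash k (realEmbedding K τ₁ Q δ) f) z := by
      rw [IsFrame.realEmbedding_mul hQ, slash_mul k hrU f z.property]
    have e2 : g (z : Fin 2 → ℂ) = slash k (realEmbedding K τ₁ Q (heckeRep S δ q : GL (Fin 3) K)) g z :=
      ((slash_eq_self_iff (IsInU21.autFactor_ne_zero hrU z.property)).mpr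
        (hg _ (heckeRep S δ q).property z z.property)).symm
    unfold peterssonPair
    rw [e1]
    conv_rhs => rw [e2]
  rw [integral_finsetSum _ fun q _ => hterm q]
  rw [Finset.sum_congr rfl fun q _ => setIntegral_peterssonPair_slash_mul hQ S hS hδ (heckeRep S δ q) hDm f hg]
  symm
  have hdisj : Pairwise (Function.onFun (AEDisjoint bergmanBall)
      fun q : S ⧸ (heckeSubgroup S δ).subgroupOf S => heckeRep S δ q • D) := by
    intro q q' hqq'
    have hne : heckeRep S δ q ≠ heckeRep S δ q' := fun h => hqq' (heckeRep_injective S δ h)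
    exact hD.aedisjoint hne
  show ∫ z in ⋃ q : S ⧸ (heckeSubgroup S δ).subgroupOf S, heckeRep S δ q • D,
      peterssonPair k (slash k (realEmbedding K τ₁ Q δ) f) g (z : Fin 2 → ℂ) ∂bergmanBall = _
  rw [integral_iUnion_ae (fun q => (hDm.const_smul _).nullMeasurableSet) hdisj hintU, tsum_fintype]

end Main

section Bridge

variable (hQ : IsFrame K τ₁ H Q) (S : Subgroup (GL (Fin 3) K))
    (hS : (S : Set (GL (Fin 3) K)) ⊆ unitaryGroup K H)

omit [NumberField K] [NumberField.IsCMField K] in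
/-- Conjugation by `δ⁻¹` carries `S_{δ⁻¹}` onto `S_δ`. -/
def heckeConjEquiv (δ : GL (Fin 3) K) : heckeSubgroup S δ⁻¹ ≃ heckeSubgroup S δ where
  toFun g := ⟨δ⁻¹ * g * δ, by
    obtain ⟨h1, h2⟩ := (mem_heckeSubgroup S δ⁻¹).mp g.property
    rw [inv_inv] at h2
    refine (mem_heckeSubgroup S δ).mpr ⟨h2, ?_⟩
    have : δ * (δ⁻¹ * (g : GL (Fin 3) K) * δ) * δ⁻¹ = g := by group
    rw [this]
    exact h1⟩
  invFun g := ⟨δ * g * δ⁻¹, by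
    obtain ⟨h1, h2⟩ := (mem_heckeSubgroup S δ).mp g.property
    refine (mem_heckeSubgroup S δ⁻¹).mpr ⟨h2, ?_⟩
    have : δ⁻¹ * (δ * (g : GL (Fin 3) K) * δ⁻¹) * δ⁻¹⁻¹ = g := by group
    rw [this]
    exact h1⟩
  left_inv g := Subtype.ext (by simp only; group)
  right_inv g := Subtype.ext (by simp only; group)

omit [NumberField K] [NumberField.IsCMField K] in
/-- The underlying element of `heckeConjEquiv`. -/
theorem coe_heckeConjEquiv_apply (δ : GL (Fin 3) K) (g : heckeSubgroup S δ⁻¹) :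
    ((heckeConjEquiv S δ g : heckeSubgroup S δ) : GL (Fin 3) K) = δ⁻¹ * g * δ := rfl

/-- **`δ` carries fundamental domains of `S_δ` to fundamental domains of `S_{δ⁻¹} = δ S_δ δ⁻¹`.** -/
theorem isBallFundamentalDomain_image_hecke {δ : GL (Fin 3) K} (hδ : δ ∈ unitaryGroup K H) {D₁ : Set ball₂}
    (hD₁ : IsBallFundamentalDomain hQ (heckeSubgroup S δ) (heckeSubgroup_subset_unitaryGroup S hS δ) D₁) :
    IsBallFundamentalDomain hQ (heckeSubgroup S δ⁻¹) (heckeSubgroup_subset_unitaryGroup S hS δ⁻¹)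
      (ballMeasurableEquiv hQ hδ '' D₁) := by
  letI := frameAction hQ (heckeSubgroup S δ) (heckeSubgroup_subset_unitaryGroup S hS δ)
  letI := frameAction hQ (heckeSubgroup S δ⁻¹) (heckeSubgroup_subset_unitaryGroup S hS δ⁻¹)
  refine hD₁.image_of_equiv (ballMeasurableEquiv hQ hδ).toEquiv ?_ (heckeConjEquiv S δ) ?_
  · exact (measurePreserving_ballMeasurableEquiv hQ (inv_mem hδ)).quasiMeasurePreserving
  · intro g x
    apply Subtype.ext
    simp only [MeasurableEquiv.coe_toEquiv, coe_ballMeasurableEquiv_apply, frameAction_smul_coe,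
      coe_heckeConjEquiv_apply]
    have hg' : IsInU21 (realEmbedding K τ₁ Q (δ⁻¹ * (g : GL (Fin 3) K) * δ)) :=
      IsFrame.isInU21_realEmbedding hQ (hS (heckeSubgroup_le S δ (heckeConjEquiv S δ g).property))
    have hδ' : IsInU21 (realEmbedding K τ₁ Q δ) := IsFrame.isInU21_realEmbedding hQ hδ
    rw [← IsInU21.ballAction_mul hg' x.property, ← IsInU21.ballAction_mul hδ' x.property,
      ← IsFrame.realEmbedding_mul hQ, ← IsFrame.realEmbedding_mul hQ]
    congr 2
    group

/-- `(g ∥ δ⁻¹) ∥ δ = g` on the ball. -/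
theorem slash_inv_slash (hQ : IsFrame K τ₁ H Q) {δ : GL (Fin 3) K} (hδ : δ ∈ unitaryGroup K H) (k : ℕ)
    (g : (Fin 2 → ℂ) → ℂ)
    {z : Fin 2 → ℂ} (hz : z ∈ ball₂) :
    slash k (realEmbedding K τ₁ Q δ) (slash k (realEmbedding K τ₁ Q δ⁻¹) g) z = g z := by
  have hδU : IsInU21 (realEmbedding K τ₁ Q δ) := IsFrame.isInU21_realEmbedding hQ hδ
  rw [← slash_mul k hδU g hz, ← IsFrame.realEmbedding_mul hQ, inv_mul_cancel, IsFrame.realEmbedding_one hQ,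
    slash_one]

/-- **The bridge**: `⟨f ∥ δ, g⟩_{S_δ} = ⟨f, g ∥ δ⁻¹⟩_{S_{δ⁻¹}}` for fundamental domains `D₁` of `S_δ` and
`D₂` of `S_{δ⁻¹}` (measurable) and continuous weight-`k` forms `f, g` for `S`. -/
theorem peterssonInner_slash_hecke_bridge {δ : GL (Fin 3) K} (hδ : δ ∈ unitaryGroup K H) {D₁ D₂ : Set ball₂}
    (hD₁m : MeasurableSet D₁)
    (hD₁ : IsBallFundamentalDomain hQ (heckeSubgroup S δ) (heckeSubgroup_subset_unitaryGroup S hS δ) D₁)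
    (hD₂ : IsBallFundamentalDomain hQ (heckeSubgroup S δ⁻¹) (heckeSubgroup_subset_unitaryGroup S hS δ⁻¹) D₂)
    {k : ℕ} {f g : (Fin 2 → ℂ) → ℂ} (hf : IsWeightFor τ₁ Q S k f) (hg : IsWeightFor τ₁ Q S k g)
    (hfc : ContinuousOn f ball₂) (hgc : ContinuousOn g ball₂) :
    peterssonInner hQ (heckeSubgroup S δ) (heckeSubgroup_subset_unitaryGroup S hS δ)
        (quotientMeasure hQ (heckeSubgroup S δ) _ D₁) (hf.slash_heckeSubgroup S hQ hS hδ)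
        (hg.mono (heckeSubgroup_le S δ)) =
      peterssonInner hQ (heckeSubgroup S δ⁻¹) (heckeSubgroup_subset_unitaryGroup S hS δ⁻¹)
        (quotientMeasure hQ (heckeSubgroup S δ⁻¹) _ D₂) (hf.mono (heckeSubgroup_le S δ⁻¹))
        (hg.slash_heckeSubgroup S hQ hS (inv_mem hδ)) := by
  have hδU : IsInU21 (realEmbedding K τ₁ Q δ) := IsFrame.isInU21_realEmbedding hQ hδ
  have hδU' : IsInU21 (realEmbedding K τ₁ Q δ⁻¹) := IsFrame.isInU21_realEmbedding hQ (inv_mem hδ)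
  rw [peterssonInner_quotientMeasure hQ _ _ _ _ _ (continuousOn_slash k hδU hfc) hgc,
    peterssonInner_quotientMeasure hQ _ _ _ _ _ hfc (continuousOn_slash k hδU' hgc)]
  calc ∫ z in D₁, peterssonPair k (slash k (realEmbedding K τ₁ Q δ) f) g (z : Fin 2 → ℂ) ∂bergmanBall
      = ∫ z in D₁, peterssonPair k f (slash k (realEmbedding K τ₁ Q δ⁻¹) g)
          ((ballMeasurableEquiv hQ hδ z : ball₂) : Fin 2 → ℂ) ∂bergmanBall := by
        refine setIntegral_congr_fun hD₁m fun z _ => ?_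
        rw [coe_ballMeasurableEquiv_apply, ← peterssonPair_slash k hδU f _ z.property]
        unfold peterssonPair
        rw [slash_inv_slash hQ hδ k g z.property]
    _ = ∫ w in ballMeasurableEquiv hQ hδ '' D₁, peterssonPair k f (slash k (realEmbedding K τ₁ Q δ⁻¹) g)
          (w : Fin 2 → ℂ) ∂bergmanBall :=
        setIntegral_ballMeasurableEquiv hQ hδ
          (fun w : ball₂ => peterssonPair k f (slash k (realEmbedding K τ₁ Q δ⁻¹) g) (w : Fin 2 → ℂ)) D₁
    _ = ∫ z in D₂, peterssonPair k f (slash k (realEmbedding K τ₁ Q δ⁻¹) g) (z : Fin 2 → ℂ) ∂bergmanBall :=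
        setIntegral_peterssonPair_eq hQ (heckeSubgroup S δ⁻¹) _
          (isBallFundamentalDomain_image_hecke hQ S hS hδ hD₁) hD₂ (hf.mono (heckeSubgroup_le S δ⁻¹))
          (hg.slash_heckeSubgroup S hQ hS (inv_mem hδ))

end Bridge

section SelfAdjoint

variable (hQ : IsFrame K τ₁ H Q) (S : Subgroup (GL (Fin 3) K))
    (hS : (S : Set (GL (Fin 3) K)) ⊆ unitaryGroup K H)

/-- `cosetDomain D` is measurable for measurable `D`. -/
theorem measurableSet_cosetDomain {S' : Subgroup (GL (Fin 3) K)} [Finite (S ⧸ S'.subgroupOf S)]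
    {D : Set ball₂} (hDm : MeasurableSet D) : MeasurableSet (cosetDomain hQ hS (S' := S') D) := by
  letI := frameAction hQ S hS
  haveI : MeasurableConstSMul S ball₂ := measurableConstSMul_frameAction hQ S hS
  haveI : Countable (S ⧸ S'.subgroupOf S) := Finite.to_countable
  exact MeasurableSet.iUnion fun q => hDm.const_smul _

/-- **Hecke operators are self-adjoint for the Petersson inner product**:
`⟨T_δ f, g⟩ = ⟨f, T_{δ⁻¹} g⟩` on a compact quotient `S\𝔹²`, for continuous weight-`k` forms `f, g` for
`S` and `δ ∈ U(H)(K)` with `[S : S_δ], [S : S_{δ⁻¹}] < ∞`. -/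
theorem peterssonInner_hecke_adjoint {δ : GL (Fin 3) K} (hδ : δ ∈ unitaryGroup K H)
    [Fintype (S ⧸ (heckeSubgroup S δ).subgroupOf S)] [Fintype (S ⧸ (heckeSubgroup S δ⁻¹).subgroupOf S)]
    [CompactSpace (ballQuotient hQ S hS)] {D : Set ball₂} (hDm : MeasurableSet D)
    (hD : IsBallFundamentalDomain hQ S hS D) {k : ℕ} {f g : (Fin 2 → ℂ) → ℂ}
    (hf : IsWeightFor τ₁ Q S k f) (hg : IsWeightFor τ₁ Q S k g) (hfc : ContinuousOn f ball₂)
    (hgc : ContinuousOn g ball₂) :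
    peterssonInner hQ S hS (quotientMeasure hQ S hS D) (hf.hecke hQ S hS hδ) hg =
      peterssonInner hQ S hS (quotientMeasure hQ S hS D) hf (hg.hecke hQ S hS (inv_mem hδ)) := by
  haveI : Finite (S ⧸ (heckeSubgroup S δ).subgroupOf S) := Finite.of_fintype _
  haveI : Finite (S ⧸ (heckeSubgroup S δ⁻¹).subgroupOf S) := Finite.of_fintype _
  haveI : ((heckeSubgroup S δ).subgroupOf S).FiniteIndex := Subgroup.finiteIndex_of_finite_quotient
  haveI : ((heckeSubgroup S δ⁻¹).subgroupOf S).FiniteIndex := Subgroup.finiteIndex_of_finite_quotient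
  rw [peterssonInner_hecke_left hQ S hS hδ hDm hD hf hg hfc hgc,
    peterssonInner_swap hQ S hS _ (hg.hecke hQ S hS (inv_mem hδ)) hf,
    peterssonInner_hecke_left hQ S hS (inv_mem hδ) hDm hD hg hf hgc hfc,
    ← peterssonInner_swap hQ (heckeSubgroup S δ⁻¹) _ _ _ _]
  exact peterssonInner_slash_hecke_bridge hQ S hS hδ (measurableSet_cosetDomain hQ S hS hDm)
    (isBallFundamentalDomain_cosetDomain hQ (heckeSubgroup_le S δ) hS hDm hD)
    (isBallFundamentalDomain_cosetDomain hQ (heckeSubgroup_le S δ⁻¹) hS hDm hD) hf hg hfc hgc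

end SelfAdjoint

end Summit.Ventures.HodgeRepro2.ShimuraData
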